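import Literature.Geometry.Lorentzian.TeukolskyWhitingRealAxis
import Literature.Geometry.Lorentzian.TeukolskyWhitingEndgame
import Literature.Geometry.Lorentzian.TeukolskyHorizonVanishing
import HarnessLib

/-!
# Real-axis mode stability for non-positive spin (Teixeira da Costa 2020, Thm. 4.1 for `s ≤ 0`,
# `|a| < M`)

Part of the proof programme for the named fact
`Literature.Geometry.Lorentzian.Kerr.Costa2019_realAxisModeStability` (R. Teixeira da Costa,
Commun. Math. Phys. 378 (2020) 705–781 = arXiv:1910.02854 [Costa2019], Thm. 4.1). This file
assembles §4.2 of the source: for `s ≤ 0` (`2s ∈ ℤ`), real `ω ≠ 0` and `|a| < M`, a classical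
solution of the radial Teukolsky ODE which is outgoing at `𝓗⁺` and `𝓘⁺` vanishes identically
(`Costa2019.modeStability_nonpos`): the real-axis Whiting transform
(`Costa2019.realAxis_transform`, Prop. 3.8 (1)–(3)) is killed by the `T`-current and the
unique continuation lemma (`Costa2019.tildeSolution_eq_zero`, Lemma 4.1 and §4.2), injectivity
at the horizon (`realAxis_transform`, last clause: Prop. 3.8 (4) / Lemma 3.14) makes the horizon
coefficient of `R` vanish, and an outgoing solution flat at the horizon is zero
(`Costa2019.radial_eq_zero_of_horizon_flat`). Everything is proved; theorems only (D-0026).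

## References
* R. Teixeira da Costa, CMP 378 (2020) 705–781, arXiv:1910.02854, Prop. 3.8, Lemma 4.1, §4.2.
  [Costa2019]
-/

noncomputable section

open Complex Set Filter Topology

namespace Literature.Geometry.Lorentzian.Kerr

namespace Costa2019

/-- **Theorem 4.1 for `s ≤ 0`, `|a| < M`, real `ω ≠ 0`** (TdC §4.2): a classical solution of the
homogeneous radial Teukolsky ODE of spin `s ≤ 0` (`2s ∈ ℤ`) which is outgoing at `𝓗⁺` and at
`𝓘⁺` vanishes identically on `(r₊, ∞)`. [cite: Costa2019, Theorem 4.1 (case s ≤ 0), §4.2] -/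
theorem modeStability_nonpos {M a : ℝ} (hM : 0 < M) (ha : |a| < M) {s : ℝ} (hs : s ≤ 0)
    {k₀ : ℤ} (hk₀ : 2 * s = k₀) {ω : ℝ} (hω : ω ≠ 0) (m lam : ℝ) {R : ℝ → ℂ}
    (hsol : IsRadialTeukolskySolution M a s ω m lam R) (hH : IsOutgoingAtHorizon M a s ω m R)
    (hI : IsOutgoingAtInfinity M s ω R) : ∀ r, rPlus M a < r → R r = 0 := by
  obtain ⟨G₀, G₁, G₂, hG₀, hG₁, hT, hnear, hfar, hinj⟩ :=
    realAxis_transform hM ha hs hk₀ hω (m := m) (lam := lam) hsol hH hI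
  have hzero : ∀ x, rPlus M a < x → G₀ x = 0 :=
    tildeSolution_eq_zero hM ha hs hω m lam hG₀ hG₁ hT hnear hfar
  exact radial_eq_zero_of_horizon_flat hM ha (by linarith) hsol hH (hinj hzero)

end Costa2019

end Literature.Geometry.Lorentzian.Kerr

end
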